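import Summits.FinalStateConjecture.FinalStateConjecture.Theorems.EIHFluxBalanceInertialRecessionStubFirstOrderCoreB
import Literature.Geometry.Lorentzian.KerrSurfaceGravity

/-!
# Route EIHFluxBalance — `InertialRecession` (E′), line `SketchCleanExcision`, skeleton r13:
# registered stub `stub_firstOrderSlaving` (D) — first-order slaving of the painted moduli by
# linear absorption of the momentum rows

File for the crux `stmt-FinalStateConjecture-17403`
(`Summit.FinalStateConjecture.FinalStateConjecture.Theses.EIHFluxBalance.InertialRecession`, E′),
stub (D) of skeleton r13 (design memo `Cruxes/InertialRecession/Lines/SketchCleanExcision.md`).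

* `firstOrder_core` — **the core estimate**: combining the own-term extraction
  (`firstOrder_coreA`, from the momentum coercivity (Bs) of hole `i` applied to the translated frozen
  background) with the pointwise chain of estimates (`firstOrder_coreB`: (ML) splitting and far
  bounds, `W`-invisibility, the momentum clause (M), Ricci-flatness of the own frozen summand), for
  every `ε > 0`, eventually in the lab time, `redᵢ(t) ≤ ε (1 + Σⱼ redⱼ(t))` for the reduced body
  rates `redⱼ = ‖Aⱼe₀‖ + ‖dⱼ~‖ + ‖aⱼ · Aⱼe₃‖`; all constants are fixed before the time.
* `stub_firstOrderSlaving` — the registered stub: `redᵢ → 0` by linear absorption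
  (`firstOrder_absorb`), hence `u̇ᵢ → 0`, `ξ̇ᵢ − vᵢ → 0`, and `ṅᵢ → 0` for `aᵢ ≠ 0`
  (`firstOrder_first_of_tendsto`).

No definitions, no named facts.
-/

set_option linter.dupNamespace false
set_option maxSynthPendingDepth 6
set_option synthInstance.maxHeartbeats 200000

noncomputable section

open scoped Topology BigOperators
open Filter Set Function Metric Literature.Geometry.Lorentzian Literature.Geometry.Lorentzian.MetricCoord
  Summit.FinalStateConjecture.FinalStateConjecture.Theorems

namespace Summit.FinalStateConjecture.FinalStateConjecture.Theorems.SublinearIsFree.Slaving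

section Core

variable {N : ℕ} {M a rin : Fin N → ℝ} {Λ : Fin N → ℝ → lorentzGroup} {ξ : Fin N → ℝ → E3} {γ : ℝ}

-- the algebraic and the operator-norm instance paths on `E4 →L[ℝ] E4 →L[ℝ] ℝ` unify slowly
set_option synthInstance.maxHeartbeats 200000 in
set_option maxHeartbeats 6400000 in
/-- **The core estimate of the first-order slaving.** Under the kinematic clauses of the crux
antecedent, the row calculus (ML), the quantitative momentum coercivity (Bs) of hole `i` and the
momentum clause (M): for every `ε > 0`, eventually in the lab time `t`,
`redᵢ(t) ≤ ε (1 + Σⱼ redⱼ(t))`, where `redⱼ(t) = ‖Aⱼe₀‖ + ‖dⱼ~‖ + ‖aⱼ · Aⱼe₃‖` is the reduced body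
rate of hole `j` (`Aⱼ = (d/ds Λⱼ⁻¹)∘Λⱼ(t)`, `dⱼ = −Λⱼ(t)⁻¹ċⱼ(t)`). [cite: KerrSchild1965, §3] -/
theorem firstOrder_core (H1 : (∀ i, Kerr.IsSubextremal (M i) (a i) ∧ Kerr.rMinus (M i) (a i) < rin i ∧ rin i < Kerr.rPlus (M i) (a i))) (Hγ : (∀ i t, |((Λ i t : E4 ≃L[ℝ] E4) (E4.basisVector 0)) 0| ≤ γ)) (Hsm : (∀ i, ContDiff ℝ ((⊤ : ℕ∞) : WithTop ℕ∞) (ξ i) ∧ ContDiff ℝ ((⊤ : ℕ∞) : WithTop ℕ∞) (fun t ↦ ((Λ i t : E4 ≃L[ℝ] E4) : E4 →L[ℝ] E4))))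
    (Hsep : (∀ i j, i ≠ j → Tendsto (fun t ↦ ‖ξ i t - ξ j t‖) atTop atTop)) (ML : (∀ {G G₁ G₂ G₃ : E4 → E4 →L[ℝ] E4 →L[ℝ] ℝ} {V : Set E4} {x : E4} {n : E4 →L[ℝ] ℝ} {A₁ A₂ : E4 →L[ℝ] E4 →L[ℝ] ℝ} {P₁ P₂ : E4 →L[ℝ] E4 →L[ℝ] E4 →L[ℝ] ℝ} {W₁ W₂ W₃ : E4 →L[ℝ] E4 →L[ℝ] ℝ} (c₁ c₂ : ℝ), MetricCoord.IsMetricOn G V → MetricCoord.IsMetricOn G₁ V → MetricCoord.IsMetricOn G₂ V → MetricCoord.IsMetricOn G₃ V → x ∈ V → G₁ x = G x → G₂ x = G x → G₃ x = G x → fderiv ℝ G₁ x = fderiv ℝ G x + n.smulRight A₁ → fderiv ℝ G₂ x = fderiv ℝ G x + n.smulRight A₂ → fderiv ℝ G₃ x = fderiv ℝ G x + n.smulRight (c₁ • A₁ + c₂ • A₂) → (∀ v, fderiv ℝ (fderiv ℝ G₁) x v = fderiv ℝ (fderiv ℝ G) x v + (n v • P₁ + n.smulRight (P₁ v) + n v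 • n.smulRight W₁)) → (∀ v, fderiv ℝ (fderiv ℝ G₂) x v = fderiv ℝ (fderiv ℝ G) x v + (n v • P₂ + n.smulRight (P₂ v) + n v • n.smulRight W₂)) → (∀ v, fderiv ℝ (fderiv ℝ G₃) x v = fderiv ℝ (fderiv ℝ G) x v + (n v • (c₁ • P₁ + c₂ • P₂) + n.smulRight ((c₁ • P₁ + c₂ • P₂) v) + n v • n.smulRight W₃)) → ∀ e : E4, n e = 0 → MetricCoord.ricAt G₃ x (MetricCoord.sharpAt G x n) e - MetricCoord.ricAt G x (MetricCoord.sharpAt G x n) e = c₁ * (MetricCoord.ricAt G₁ x (MetricCoord.sharpAt G x n) e - MetricCoord.ricAt G x (MetricCoord.sharpAt G x n) e) + c₂ * (MetricCoord.ricAt G₂ x (MetricCoord.sharpAt G x n) e - MetricCoord.ricAt G x (MetricCoord.sharpAt G x n) e)) ∧ (∀ μ ν : ℝ, 0 < μ → ∃ C : ℝ, ∀ {G G₁ : E4 → E4 →L[ℝ] E4 →L[ℝ] ℝ} {V : Set E4} {x : E4} {n : E4 →L[ℝ] ℝ} {A : E4 →L[ℝ] E4 →L[ℝ] ℝ} {P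 : E4 →L[ℝ] E4 →L[ℝ] E4 →L[ℝ] ℝ} {W : E4 →L[ℝ] E4 →L[ℝ] ℝ}, MetricCoord.IsMetricOn G V → MetricCoord.IsMetricOn G₁ V → x ∈ V → (∀ v : E4, μ * ‖v‖ ≤ ‖G x v‖) → ‖G x‖ ≤ ν → G₁ x = G x → fderiv ℝ G₁ x = fderiv ℝ G x + n.smulRight A → (∀ v, fderiv ℝ (fderiv ℝ G₁) x v = fderiv ℝ (fderiv ℝ G) x v + (n v • P + n.smulRight (P v) + n v • n.smulRight W)) → ∀ e : E4, n e = 0 → |MetricCoord.ricAt G₁ x (MetricCoord.sharpAt G x n) e - MetricCoord.ricAt G x (MetricCoord.sharpAt G x n) e| ≤ C * (1 + ‖fderiv ℝ G x‖) * (‖A‖ + ‖P‖) * ‖n‖ ^ 2 * ‖e‖)) (i : Fin N)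
    (BSi : (∃ c ρin ρout η₀ : ℝ, 0 < c ∧ 0 < η₀ ∧ 0 < ρin ∧ ρin ≤ ρout ∧ (∀ (L : lorentzGroup) (y : E3), |((L : E4 ≃L[ℝ] E4) (E4.basisVector 0)) 0| ≤ γ → ρin ≤ ‖y‖ → 2 * (M i) < Kerr.radius (a i) (poincareInv L 0 (E4.ofTimeSpace 0 y))) ∧ ∀ (L : lorentzGroup) (A : E4 →L[ℝ] E4) (d : E4) (G : E4 → E4 →L[ℝ] E4 →L[ℝ] ℝ) (V : Set E4), |((L : E4 ≃L[ℝ] E4) (E4.basisVector 0)) 0| ≤ γ → (∀ u w : E4, Minkowski.bilin (A u) w + Minkowski.bilin u (A w) = 0) → MetricCoord.IsMetricOn G V → (∀ y : E3, ρin ≤ ‖y‖ → ‖y‖ ≤ ρout → (E4.ofTimeSpace 0 y) ∈ V ∧ ‖G (E4.ofTimeSpace 0 y) - boostedKerrBilin L 0 (M i) (a i) (E4.ofTimeSpace 0 y)‖ ≤ η₀ ∧ ‖fderiv ℝ G (E4.ofTimeSpace 0 y) - fderiv ℝ (boostedKerrBilin L 0 (M i) (a i)) (E4.ofTimeSpace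 0 y)‖ ≤ η₀ ∧ ‖fderiv ℝ (fderiv ℝ G) (E4.ofTimeSpace 0 y) - fderiv ℝ (fderiv ℝ (boostedKerrBilin L 0 (M i) (a i))) (E4.ofTimeSpace 0 y)‖ ≤ η₀) → ∃ y : E3, ρin ≤ ‖y‖ ∧ ‖y‖ ≤ ρout ∧ c * (‖A (E4.basisVector 0)‖ + ‖E4.spatial d‖ + ‖(a i) • A (E4.basisVector 3)‖) ≤ ∑ j : Fin 3, |MetricCoord.ricAt (fun z : E4 ↦ G z + (z 0) • ((fderiv ℝ (Kerr.bilin (M i) (a i)) (poincareInv L 0 z) (A (poincareInv L 0 z) + d)).bilinearComp (((L : E4 ≃L[ℝ] E4).symm : E4 →L[ℝ] E4)) (((L : E4 ≃L[ℝ] E4).symm : E4 →L[ℝ] E4)) + (Kerr.bilin (M i) (a i) (poincareInv L 0 z)).bilinearComp (A.comp (((L : E4 ≃L[ℝ] E4).symm : E4 →L[ℝ] E4))) (((L : E4 ≃L[ℝ] E4).symm : E4 →L[ℝ] E4)) + (Kerr.bilin (M i) (a i) (poincareInv L 0 z)).bilinearComp (((L : E4 ≃L[ℝ] E4).symm : E4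 →L[ℝ] E4)) (A.comp (((L : E4 ≃L[ℝ] E4).symm : E4 →L[ℝ] E4))))) (E4.ofTimeSpace 0 y) (MetricCoord.sharpAt G (E4.ofTimeSpace 0 y) (E4.dx 0)) (E4.basisVector j.succ) - MetricCoord.ricAt G (E4.ofTimeSpace 0 y) (MetricCoord.sharpAt G (E4.ofTimeSpace 0 y) (E4.dx 0)) (E4.basisVector j.succ)|)) (MCL : (∀ (i : Fin N) (R r₀ : ℝ), rin i ≤ r₀ → ∀ ε : ℝ, 0 < ε → ∃ T : ℝ, ∀ x : E4, T < x 0 → ‖E4.spatial x - ξ i (x 0)‖ < R → r₀ < Kerr.radius (a i) (poincareInv (Λ i (x 0)) (E4.ofTimeSpace (x 0) (ξ i (x 0))) x) → ∀ l : ℝ, 1 ≤ l → ‖fderiv ℝ (fun z : E4 ↦ Minkowski.bilin + ∑ i, (boostedKerrBilin (Λ i (z 0)) (E4.ofTimeSpace (z 0) (ξ i (z 0))) (M i) (a i) z - Minkowski.bilin)) x‖ ≤ l → (∀ w : E4, w 0 = 0 → ‖fderiv ℝ (fderiv ℝ (fun z : E4 ↦ Minkowski.bilin + ∑ i, (boostedKerrBilin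 (Λ i (z 0)) (E4.ofTimeSpace (z 0) (ξ i (z 0))) (M i) (a i) z - Minkowski.bilin))) x w‖ ≤ l * ‖w‖) → ∀ j : Fin 3, |MetricCoord.ricAt (fun z : E4 ↦ Minkowski.bilin + ∑ i, (boostedKerrBilin (Λ i (z 0)) (E4.ofTimeSpace (z 0) (ξ i (z 0))) (M i) (a i) z - Minkowski.bilin)) x (MetricCoord.sharpAt (fun z : E4 ↦ Minkowski.bilin + ∑ i, (boostedKerrBilin (Λ i (z 0)) (E4.ofTimeSpace (z 0) (ξ i (z 0))) (M i) (a i) z - Minkowski.bilin)) x (E4.dx 0)) (E4.basisVector j.succ)| ≤ ε * l)) {ε : ℝ} (hε : 0 < ε) :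
    ∀ᶠ t in atTop, (‖((deriv (fun s ↦ (((Λ i s : E4 ≃L[ℝ] E4).symm : E4 →L[ℝ] E4))) t).comp ((Λ i t : E4 ≃L[ℝ] E4) : E4 →L[ℝ] E4)) (E4.basisVector 0)‖ + ‖E4.spatial (-((((Λ i t : E4 ≃L[ℝ] E4).symm : E4 →L[ℝ] E4)) (deriv (fun s ↦ E4.ofTimeSpace s (ξ i s)) t)))‖ + ‖(a i) • ((deriv (fun s ↦ (((Λ i s : E4 ≃L[ℝ] E4).symm : E4 →L[ℝ] E4))) t).comp ((Λ i t : E4 ≃L[ℝ] E4) : E4 →L[ℝ] E4)) (E4.basisVector 3)‖) ≤ ε * (1 + ∑ j, (‖((deriv (fun s ↦ (((Λ j s : E4 ≃L[ℝ] E4).symm : E4 →L[ℝ] E4))) t).comp ((Λ j t : E4 ≃L[ℝ] E4) : E4 →L[ℝ] E4)) (E4.basisVector 0)‖ + ‖E4.spatial (-((((Λ j t : E4 ≃L[ℝ] E4).symm : E4 →L[ℝ] E4)) (deriv (fun s ↦ E4.ofTimeSpace s (ξ j s)) t)))‖ + ‖(a j) • ((deriv (fun s ↦ (((Λ j s : E4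 ≃L[ℝ] E4).symm : E4 →L[ℝ] E4))) t).comp ((Λ j t : E4 ≃L[ℝ] E4) : E4 →L[ℝ] E4)) (E4.basisVector 3)‖)) := by
  classical
  obtain ⟨c, ρin, ρout, η₀, hc, hη₀, hρin, hρio, hradc, hBS⟩ := BSi
  have hMi : 0 < M i := (H1 i).1.pos
  have hN0 : (0 : ℝ) ≤ N := Nat.cast_nonneg N
  set r₀ : ℝ := 2 * M i with hr₀
  have hr₀0 : 0 < r₀ := by positivity
  -- coercivity and size constants of the frozen background
  set K : ℝ := (1 + 3 * γ) ^ 2 * (1 + 4 * (|M i| / r₀)) with hK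
  have hγ1 : 1 ≤ γ := (one_le_abs_lorentz_apply_zero (Λ i 0)).trans (Hγ i 0)
  have hK1 : 1 ≤ K := by
    have h1 : (1 : ℝ) ≤ (1 + 3 * γ) ^ 2 := by nlinarith
    have h2 : (1 : ℝ) ≤ 1 + 4 * (|M i| / r₀) := by
      have : 0 ≤ |M i| / r₀ := by positivity
      linarith
    nlinarith
  have hK0 : 0 < K := by linarith
  set μ : ℝ := K⁻¹ / 2 with hμ
  have hμ0 : 0 < μ := by positivity
  set ν : ℝ := ‖(Minkowski.bilin : E4 →L[ℝ] E4 →L[ℝ] ℝ)‖ + ∑ j, 4 * (|M j| / min r₀ 1) * (1 + 3 * γ) ^ 2 with hν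
  obtain ⟨CML, hML2⟩ := ML.2 μ ν hμ0
  obtain ⟨B, hB0, hBsh⟩ := firstOrder_shell_bounds (M i) (a i) γ ρout hr₀0
  set s : ℝ := max 1 (2 * K) with hs
  have hs1 : 1 ≤ s := le_max_left _ _
  have hs0 : 0 < s := by positivity
  set Cstar : ℝ := B + N + 1 with hCstar
  have hCstar0 : 0 < Cstar := by positivity
  set Cpert : ℝ := 12 * (s ^ 3 * (5 * (B + 2 * N) ^ 2 + (B + 2 * N)) + 5 * s ^ 2 * (B + 2 * N) + s) * N
    with hCpert
  have hCpert0 : 0 ≤ Cpert := by positivity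
  set Cfar : ℝ := max CML 0 * (1 + (B + N)) with hCfar
  have hCfar0 : 0 ≤ Cfar := by positivity
  -- the smallness parameters
  set ε₁ : ℝ := c * ε / (9 * Cstar) with hε₁
  have hε₁0 : 0 < ε₁ := by positivity
  set δf : ℝ := min (min 1 (η₀ / (N + 1))) (c * ε / (9 * (Cpert * s + 1))) with hδf
  have hδf0 : 0 < δf := by positivity
  have hδf1 : δf ≤ 1 := (min_le_left _ _).trans (min_le_left _ _)
  have hNδ : (N : ℝ) * δf ≤ η₀ := by
    have h1 : δf ≤ η₀ / (N + 1) := (min_le_left _ _).trans (min_le_right _ _)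
    have h2 : (N : ℝ) * (η₀ / (N + 1)) ≤ η₀ := by
      rw [mul_div_assoc', div_le_iff₀ (by positivity)]
      nlinarith
    exact (mul_le_mul_of_nonneg_left h1 hN0).trans h2
  set δv : ℝ := min 1 (c * ε / (9 * (Cfar + 1))) with hδv
  have hδv0 : 0 < δv := by positivity
  have hδv1 : δv ≤ 1 := min_le_left _ _
  -- the events
  obtain ⟨T₁, hT₁⟩ := MCL i (ρout + 1) (rin i) le_rfl ε₁ hε₁0
  have E1 := eventually_ansatz_coercive_near_hole (M := M) (a := a) Hγ Hsep i ρout hr₀0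
  have E2 := eventually_norm_ansatz_le_near_hole (M := M) (a := a) Hγ Hsep i ρout hr₀0
  have E3 := firstOrder_frozen_far_jets (M := M) (a := a) Hγ Hsep i ρout hδf0
  have E4' := firstOrder_frozen_far_variation (M := M) (a := a) Hγ Hsm Hsep i ρout hδv0
  filter_upwards [E1, E2, E3, E4', eventually_gt_atTop T₁] with t h1 h2 h3 h4 h5
  -- the frozen-form coercivity near hole `i`
  have hco : ∀ x : E4, x 0 = t → ‖E4.spatial x - ξ i t‖ ≤ ρout →
      2 * M i ≤ Kerr.radius (a i) (poincareInv (Λ i t) (E4.ofTimeSpace t (ξ i t)) x) →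
      (∀ j, 0 < Kerr.radius (a j) (poincareInv (Λ j t) (E4.ofTimeSpace t (ξ j t)) x)) ∧
      ∀ v : E4, μ * ‖v‖ ≤ ‖(fun z : E4 ↦ Minkowski.bilin + ∑ j, (boostedKerrBilin (Λ j t) (E4.ofTimeSpace t (ξ j t)) (M j) (a j) z - Minkowski.bilin)) x v‖ := by
    intro x hx0 hxR hri
    obtain ⟨hradii, hcoer⟩ := h1 x hx0 hxR hri
    refine ⟨hradii, fun v ↦ ?_⟩
    have h := hcoer v
    rw [hx0] at h
    exact h
  -- the own term
  obtain ⟨y, hy1, hy2, hown⟩ := firstOrder_coreA (M := M) (a := a) Hsm i hδf0.le hNδ hμ0 (Hγ i t)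
    hradc hBS h3 hco
  -- the lab event
  set x : E4 := (E4.ofTimeSpace 0 y + (E4.ofTimeSpace t (ξ i t))) with hx
  have hx0 : x 0 = t := by simp [hx]
  have hxsp : E4.spatial x - ξ i t = y := by simp [hx]
  have hxs : ‖E4.spatial x - ξ i t‖ = ‖y‖ := by rw [hxsp]
  have hpI : poincareInv (Λ i t) (E4.ofTimeSpace t (ξ i t)) x = poincareInv (Λ i t) 0 (E4.ofTimeSpace 0 y) :=
    firstOrder_poincareInv_translate _ _ _
  have hri : 2 * M i < Kerr.radius (a i) (poincareInv (Λ i t) (E4.ofTimeSpace t (ξ i t)) x) := by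
    rw [hpI]; exact hradc (Λ i t) y (Hγ i t) hy1
  have hxc : ‖x - (E4.ofTimeSpace t (ξ i t))‖ ≤ ρout := by
    rw [(sub_ofTimeSpace_apply_zero hx0 (ξ i t)).2, hxs]; exact hy2
  obtain ⟨hU, hcoer⟩ := hco x hx0 (by rw [hxs]; exact hy2) hri.le
  have hν : ‖(fun z : E4 ↦ Minkowski.bilin + ∑ j, (boostedKerrBilin (Λ j t) (E4.ofTimeSpace t (ξ j t)) (M j) (a j) z - Minkowski.bilin)) x‖ ≤ ν := by
    have h := h2 x hx0 (by rw [hxs]; exact hy2) hri.le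
    rw [hx0] at h
    exact h
  -- the own summand: invertible, `‖♯‖ ≤ s`; shell bounds
  have hSd : HasDerivAt (fun s ↦ (((Λ i s : E4 ≃L[ℝ] E4).symm : E4 →L[ℝ] E4)))
      (deriv (fun s ↦ (((Λ i s : E4 ≃L[ℝ] E4).symm : E4 →L[ℝ] E4))) t) t :=
    ((contDiff_lorentz_symm (Hsm i).2).differentiable (by simp) t).hasDerivAt
  have hA : ∀ u w : E4, Minkowski.bilin (((deriv (fun s ↦ (((Λ i s : E4 ≃L[ℝ] E4).symm : E4 →L[ℝ] E4))) t).comp ((Λ i t : E4 ≃L[ℝ] E4) : E4 →L[ℝ] E4)) u) w + Minkowski.bilin u (((deriv (fun s ↦ (((Λ i s : E4 ≃L[ℝ] E4).symm : E4 →L[ℝ] E4))) t).comp ((Λ i t : E4 ≃L[ℝ] E4) : E4 →L[ℝ] E4)) w) = 0 :=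
    fun u w ↦ minkowski_skew_of_hasDerivAt_lorentz_symm hSd u w
  obtain ⟨hB1, hB2, hBV⟩ := hBsh (Λ i t) _ (-((((Λ i t : E4 ≃L[ℝ] E4).symm : E4 →L[ℝ] E4)) (deriv (fun s ↦ E4.ofTimeSpace s (ξ i s)) t))) (E4.ofTimeSpace t (ξ i t)) x (Hγ i t) hA hxc hri.le
  have hcoF : ∀ v : E4, K⁻¹ * ‖v‖ ≤ ‖boostedKerrBilin (Λ i t) (E4.ofTimeSpace t (ξ i t)) (M i) (a i) x v‖ := by
    intro v
    have h := norm_le_const_mul_norm_boostedKerrBilin (Λ i t) (E4.ofTimeSpace t (ξ i t)) (M i) (a i) (Hγ i t) hr₀0 hri.le v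
    exact (inv_mul_le_iff₀ hK0).2 h
  have hFinv : (boostedKerrBilin (Λ i t) (E4.ofTimeSpace t (ξ i t)) (M i) (a i) x).IsInvertible := firstOrder_isInvertible_of_coercive (inv_pos.2 hK0) hcoF
  have hsF : ‖MetricCoord.sharpAt (fun z : E4 ↦ boostedKerrBilin (Λ i t) (E4.ofTimeSpace t (ξ i t)) (M i) (a i) z) x‖ ≤ s := by
    have h := norm_sharpAt_le_of_coercive (G := fun z : E4 ↦ boostedKerrBilin (Λ i t) (E4.ofTimeSpace t (ξ i t)) (M i) (a i) z) (inv_pos.2 hK0) hcoF hFinv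
    rw [inv_inv] at h
    exact h.trans ((by linarith : K ≤ 2 * K).trans (le_max_right _ _))
  have hinvG : ((fun z : E4 ↦ Minkowski.bilin + ∑ j, (boostedKerrBilin (Λ j t) (E4.ofTimeSpace t (ξ j t)) (M j) (a j) z - Minkowski.bilin)) x).IsInvertible := firstOrder_isInvertible_of_coercive hμ0 hcoer
  have hsG : ‖MetricCoord.sharpAt (fun z : E4 ↦ Minkowski.bilin + ∑ j, (boostedKerrBilin (Λ j t) (E4.ofTimeSpace t (ξ j t)) (M j) (a j) z - Minkowski.bilin)) x‖ ≤ s := by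
    have h := norm_sharpAt_le_of_coercive (G := (fun z : E4 ↦ Minkowski.bilin + ∑ j, (boostedKerrBilin (Λ j t) (E4.ofTimeSpace t (ξ j t)) (M j) (a j) z - Minkowski.bilin))) hμ0 hcoer hinvG
    have e : μ⁻¹ = 2 * K := by rw [hμ]; field_simp
    rw [e] at h
    exact h.trans (le_max_right _ _)
  -- the momentum clause at `x`
  have hrin : rin i < Kerr.radius (a i) (poincareInv (Λ i (x 0)) (E4.ofTimeSpace (x 0) (ξ i (x 0))) x) := by
    rw [hx0]
    have h1 := (H1 i).2.2
    have h2 := Kerr.rPlus_le_two_mul_self hMi.le (a i)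
    linarith
  have hMCLx := hT₁ x (by rw [hx0]; exact h5) (by rw [hx0, hxs]; linarith) hrin
  -- the pointwise chain
  have hchain := firstOrder_coreB (M := M) (a := a) ML.1 hML2 Hsm i hx0 hU hμ0 hcoer hν hB0 hδf0.le hδf1 hδv0.le hδv1
    hs1 hB1 hB2 hBV (h3 x hx0 (by rw [hxs]; exact hy2)) (h4 x hx0 (by rw [hxs]; exact hy2)) hFinv hsF hsG
    hMCLx
  -- absorb the constants
  set R : ℝ := ∑ j, (‖((deriv (fun s ↦ (((Λ j s : E4 ≃L[ℝ] E4).symm : E4 →L[ℝ] E4))) t).comp ((Λ j t : E4 ≃L[ℝ] E4) : E4 →L[ℝ] E4)) (E4.basisVector 0)‖ + ‖E4.spatial (-((((Λ j t : E4 ≃L[ℝ] E4).symm : E4 →L[ℝ] E4)) (deriv (fun s ↦ E4.ofTimeSpace s (ξ j s)) t)))‖ + ‖(a j) • ((deriv (fun s ↦ (((Λ j s : E4 ≃L[ℝ] E4).symm : E4 →L[ℝ] E4))) t).comp ((Λ j t : E4 ≃L[ℝ] E4) : E4 →L[ℝ] E4)) (E4.basisVector 3)‖) with hR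
  have hR0 : 0 ≤ R := Finset.sum_nonneg fun j _ ↦ by positivity
  have hfin := hown.trans hchain
  have hcε : 0 < c * ε := mul_pos hc hε
  have t1 : 3 * (ε₁ * ((B + N + 1) * (1 + R))) = c * ε * (1 + R) / 3 := by
    have hne : (B + N + 1 : ℝ) ≠ 0 := by positivity
    rw [hε₁, hCstar]; field_simp; ring
  have t2 : 3 * (Cpert * δf * s) ≤ c * ε * (1 + R) / 3 := by
    have h1 : δf ≤ c * ε / (9 * (Cpert * s + 1)) := min_le_right _ _
    have hden : (0 : ℝ) < 9 * (Cpert * s + 1) := by positivity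
    have key : (Cpert * s) * (c * ε / (9 * (Cpert * s + 1))) ≤ c * ε / 9 := by
      rw [mul_div_assoc', div_le_div_iff₀ hden (by norm_num : (0 : ℝ) < 9)]
      nlinarith [mul_nonneg hCpert0 hs0.le]
    have h2 : Cpert * δf * s ≤ c * ε / 9 :=
      calc Cpert * δf * s = (Cpert * s) * δf := by ring
        _ ≤ (Cpert * s) * (c * ε / (9 * (Cpert * s + 1))) := mul_le_mul_of_nonneg_left h1 (by positivity)
        _ ≤ c * ε / 9 := key
    nlinarith
  have t3 : 3 * (Cfar * δv * R) ≤ c * ε * (1 + R) / 3 := by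
    have h1 : δv ≤ c * ε / (9 * (Cfar + 1)) := min_le_right _ _
    have hden : (0 : ℝ) < 9 * (Cfar + 1) := by positivity
    have key : Cfar * (c * ε / (9 * (Cfar + 1))) ≤ c * ε / 9 := by
      rw [mul_div_assoc', div_le_div_iff₀ hden (by norm_num : (0 : ℝ) < 9)]
      nlinarith
    have h2 : Cfar * δv ≤ c * ε / 9 := (mul_le_mul_of_nonneg_left h1 hCfar0).trans key
    have h3 : Cfar * δv * R ≤ c * ε / 9 * R := mul_le_mul_of_nonneg_right h2 hR0
    nlinarith
  have hsum : 3 * (ε₁ * ((B + N + 1) * (1 + R)) + Cpert * δf * s + Cfar * δv * R) ≤ c * ε * (1 + R) := by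
    have : 3 * (ε₁ * ((B + N + 1) * (1 + R)) + Cpert * δf * s + Cfar * δv * R) =
        3 * (ε₁ * ((B + N + 1) * (1 + R))) + 3 * (Cpert * δf * s) + 3 * (Cfar * δv * R) := by ring
    rw [this, t1]; linarith
  have hkey := hfin.trans hsum
  rw [mul_assoc] at hkey
  exact le_of_mul_le_mul_left hkey hc

end Core


set_option maxHeartbeats 3200000 in
/-- **First-order slaving of the painted moduli (stub (D) of skeleton r13).** Under the kinematic
clauses of the crux antecedent, the momentum-row calculus (ML), the quantitative momentum
coercivity (Bs) of every hole and the momentum clause (M) of the frozen-vacuum slaving, the first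
lab-time jets of the painted moduli decay: `u̇ᵢ → 0`, `ξ̇ᵢ − vᵢ → 0`, and `ṅᵢ → 0` if `aᵢ ≠ 0`
(linear absorption of the momentum rows; Kerr–Schild 1965, §§2–3 for the ingredients).
[cite: KerrSchild1965, §3] -/
theorem stub_firstOrderSlaving : ∀ (N : ℕ) (M a rin : Fin N → ℝ) (Λ : Fin N → ℝ → lorentzGroup) (ξ : Fin N → ℝ → E3) (γ : ℝ), (∀ i, Kerr.IsSubextremal (M i) (a i) ∧ Kerr.rMinus (M i) (a i) < rin i ∧ rin i < Kerr.rPlus (M i) (a i)) → (∀ i t, |((Λ i t : E4 ≃L[ℝ] E4) (E4.basisVector 0)) 0| ≤ γ) → (∀ i, ContDiff ℝ ((⊤ : ℕ∞) : WithTop ℕ∞) (ξ i) ∧ ContDiff ℝ ((⊤ : ℕ∞) : WithTop ℕ∞) (fun t ↦ ((Λ i t : E4 ≃L[ℝ] E4) : E4 →L[ℝ] E4))) → (∀ i j, i ≠ j → Tendsto (fun t ↦ ‖ξ i t - ξ j t‖) atTop atTop) → (∀ {G G₁ G₂ G₃ : E4 → E4 →L[ℝ] E4 →L[ℝ] ℝ}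 {V : Set E4} {x : E4} {n : E4 →L[ℝ] ℝ} {A₁ A₂ : E4 →L[ℝ] E4 →L[ℝ] ℝ} {P₁ P₂ : E4 →L[ℝ] E4 →L[ℝ] E4 →L[ℝ] ℝ} {W₁ W₂ W₃ : E4 →L[ℝ] E4 →L[ℝ] ℝ} (c₁ c₂ : ℝ), MetricCoord.IsMetricOn G V → MetricCoord.IsMetricOn G₁ V → MetricCoord.IsMetricOn G₂ V → MetricCoord.IsMetricOn G₃ V → x ∈ V → G₁ x = G x → G₂ x = G x → G₃ x = G x → fderiv ℝ G₁ x = fderiv ℝ G x + n.smulRight A₁ → fderiv ℝ G₂ x = fderiv ℝ G x + n.smulRight A₂ → fderiv ℝ G₃ x = fderiv ℝ G x + n.smulRight (c₁ • A₁ + c₂ • A₂) → (∀ v, fderiv ℝ (fderiv ℝ G₁) x v = fderiv ℝ (fderiv ℝ G) x v + (n v • P₁ + n.smulRight (P₁ v) + n v • n.smulRight W₁)) → (∀ v, fderiv ℝ (fderiv ℝ G₂) x v = fderiv ℝ (fderiv ℝ G) x v + (n v • P₂ + n.smulRight (P₂ v) + n v • n.smulRight W₂)) → (∀ v, fderiv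 ℝ (fderiv ℝ G₃) x v = fderiv ℝ (fderiv ℝ G) x v + (n v • (c₁ • P₁ + c₂ • P₂) + n.smulRight ((c₁ • P₁ + c₂ • P₂) v) + n v • n.smulRight W₃)) → ∀ e : E4, n e = 0 → MetricCoord.ricAt G₃ x (MetricCoord.sharpAt G x n) e - MetricCoord.ricAt G x (MetricCoord.sharpAt G x n) e = c₁ * (MetricCoord.ricAt G₁ x (MetricCoord.sharpAt G x n) e - MetricCoord.ricAt G x (MetricCoord.sharpAt G x n) e) + c₂ * (MetricCoord.ricAt G₂ x (MetricCoord.sharpAt G x n) e - MetricCoord.ricAt G x (MetricCoord.sharpAt G x n) e)) ∧ (∀ μ ν : ℝ, 0 < μ → ∃ C : ℝ, ∀ {G G₁ : E4 → E4 →L[ℝ] E4 →L[ℝ] ℝ} {V : Set E4} {x : E4} {n : E4 →L[ℝ] ℝ} {A : E4 →L[ℝ] E4 →L[ℝ] ℝ} {P : E4 →L[ℝ] E4 →L[ℝ] E4 →L[ℝ] ℝ} {W : E4 →L[ℝ] E4 →L[ℝ] ℝ}, MetricCoord.IsMetricOn G V → MetricCoord.IsMetricOn G₁ V → x ∈ V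 → (∀ v : E4, μ * ‖v‖ ≤ ‖G x v‖) → ‖G x‖ ≤ ν → G₁ x = G x → fderiv ℝ G₁ x = fderiv ℝ G x + n.smulRight A → (∀ v, fderiv ℝ (fderiv ℝ G₁) x v = fderiv ℝ (fderiv ℝ G) x v + (n v • P + n.smulRight (P v) + n v • n.smulRight W)) → ∀ e : E4, n e = 0 → |MetricCoord.ricAt G₁ x (MetricCoord.sharpAt G x n) e - MetricCoord.ricAt G x (MetricCoord.sharpAt G x n) e| ≤ C * (1 + ‖fderiv ℝ G x‖) * (‖A‖ + ‖P‖) * ‖n‖ ^ 2 * ‖e‖) → (∀ i : Fin N, (∃ c ρin ρout η₀ : ℝ, 0 < c ∧ 0 < η₀ ∧ 0 < ρin ∧ ρin ≤ ρout ∧ (∀ (L : lorentzGroup) (y : E3), |((L : E4 ≃L[ℝ] E4) (E4.basisVector 0)) 0| ≤ γ → ρin ≤ ‖y‖ → 2 * (M i) < Kerr.radius (a i) (poincareInv L 0 (E4.ofTimeSpace 0 y))) ∧ ∀ (L : lorentzGroup) (A : E4 →L[ℝ] E4) (d : E4) (G : E4 → E4 →L[ℝ] E4 →L[ℝ] ℝ)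 (V : Set E4), |((L : E4 ≃L[ℝ] E4) (E4.basisVector 0)) 0| ≤ γ → (∀ u w : E4, Minkowski.bilin (A u) w + Minkowski.bilin u (A w) = 0) → MetricCoord.IsMetricOn G V → (∀ y : E3, ρin ≤ ‖y‖ → ‖y‖ ≤ ρout → (E4.ofTimeSpace 0 y) ∈ V ∧ ‖G (E4.ofTimeSpace 0 y) - boostedKerrBilin L 0 (M i) (a i) (E4.ofTimeSpace 0 y)‖ ≤ η₀ ∧ ‖fderiv ℝ G (E4.ofTimeSpace 0 y) - fderiv ℝ (boostedKerrBilin L 0 (M i) (a i)) (E4.ofTimeSpace 0 y)‖ ≤ η₀ ∧ ‖fderiv ℝ (fderiv ℝ G) (E4.ofTimeSpace 0 y) - fderiv ℝ (fderiv ℝ (boostedKerrBilin L 0 (M i) (a i))) (E4.ofTimeSpace 0 y)‖ ≤ η₀) → ∃ y : E3, ρin ≤ ‖y‖ ∧ ‖y‖ ≤ ρout ∧ c * (‖A (E4.basisVector 0)‖ + ‖E4.spatial d‖ + ‖(a i) • A (E4.basisVector 3)‖) ≤ ∑ j : Fin 3, |MetricCoord.ricAt (fun z : E4 ↦ G z +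 (z 0) • ((fderiv ℝ (Kerr.bilin (M i) (a i)) (poincareInv L 0 z) (A (poincareInv L 0 z) + d)).bilinearComp (((L : E4 ≃L[ℝ] E4).symm : E4 →L[ℝ] E4)) (((L : E4 ≃L[ℝ] E4).symm : E4 →L[ℝ] E4)) + (Kerr.bilin (M i) (a i) (poincareInv L 0 z)).bilinearComp (A.comp (((L : E4 ≃L[ℝ] E4).symm : E4 →L[ℝ] E4))) (((L : E4 ≃L[ℝ] E4).symm : E4 →L[ℝ] E4)) + (Kerr.bilin (M i) (a i) (poincareInv L 0 z)).bilinearComp (((L : E4 ≃L[ℝ] E4).symm : E4 →L[ℝ] E4)) (A.comp (((L : E4 ≃L[ℝ] E4).symm : E4 →L[ℝ] E4))))) (E4.ofTimeSpace 0 y) (MetricCoord.sharpAt G (E4.ofTimeSpace 0 y) (E4.dx 0)) (E4.basisVector j.succ) - MetricCoord.ricAt G (E4.ofTimeSpace 0 y) (MetricCoord.sharpAt G (E4.ofTimeSpace 0 y) (E4.dx 0)) (E4.basisVector j.succ)|)) → (∀ (i : Fin N) (R r₀ : ℝ), rin i ≤ r₀ → ∀ ε : ℝ, 0 < ε → ∃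 T : ℝ, ∀ x : E4, T < x 0 → ‖E4.spatial x - ξ i (x 0)‖ < R → r₀ < Kerr.radius (a i) (poincareInv (Λ i (x 0)) (E4.ofTimeSpace (x 0) (ξ i (x 0))) x) → ∀ l : ℝ, 1 ≤ l → ‖fderiv ℝ (fun z : E4 ↦ Minkowski.bilin + ∑ i, (boostedKerrBilin (Λ i (z 0)) (E4.ofTimeSpace (z 0) (ξ i (z 0))) (M i) (a i) z - Minkowski.bilin)) x‖ ≤ l → (∀ w : E4, w 0 = 0 → ‖fderiv ℝ (fderiv ℝ (fun z : E4 ↦ Minkowski.bilin + ∑ i, (boostedKerrBilin (Λ i (z 0)) (E4.ofTimeSpace (z 0) (ξ i (z 0))) (M i) (a i) z - Minkowski.bilin))) x w‖ ≤ l * ‖w‖) → ∀ j : Fin 3, |MetricCoord.ricAt (fun z : E4 ↦ Minkowski.bilin + ∑ i, (boostedKerrBilin (Λ i (z 0)) (E4.ofTimeSpace (z 0) (ξ i (z 0))) (M i) (a i) z - Minkowski.bilin)) x (MetricCoord.sharpAt (fun z : E4 ↦ Minkowski.bilin + ∑ i, (boostedKerrBilin (Λ i (z 0)) (E4.ofTimeSpace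 (z 0) (ξ i (z 0))) (M i) (a i) z - Minkowski.bilin)) x (E4.dx 0)) (E4.basisVector j.succ)| ≤ ε * l) → (∀ i : Fin N, Tendsto (fun t ↦ iteratedDeriv 1 (fun s ↦ (((Λ i s : lorentzGroup) : E4 ≃L[ℝ] E4) (E4.basisVector 0))) t) atTop (𝓝 0) ∧ Tendsto (fun t ↦ iteratedDeriv 0 (fun s ↦ deriv (ξ i) s - (((((Λ i s : lorentzGroup) : E4 ≃L[ℝ] E4) (E4.basisVector 0)) 0)⁻¹ • E4.spatial (((Λ i s : lorentzGroup) : E4 ≃L[ℝ] E4) (E4.basisVector 0)))) t) atTop (𝓝 0) ∧ (a i ≠ 0 → Tendsto (fun t ↦ iteratedDeriv 1 (fun s ↦ (((Λ i s : lorentzGroup) : E4 ≃L[ℝ] E4) (E4.basisVector 3))) t) atTop (𝓝 0))) := by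
  intro N M a rin Λ ξ γ H1 Hγ Hsm Hsep ML BS MCL
  -- the reduced body rates decay
  have hcore : ∀ (i : Fin N) (ε : ℝ), 0 < ε → ∀ᶠ t in atTop,
      (‖((deriv (fun s ↦ (((Λ i s : E4 ≃L[ℝ] E4).symm : E4 →L[ℝ] E4))) t).comp ((Λ i t : E4 ≃L[ℝ] E4) : E4 →L[ℝ] E4)) (E4.basisVector 0)‖ + ‖E4.spatial (-((((Λ i t : E4 ≃L[ℝ] E4).symm : E4 →L[ℝ] E4)) (deriv (fun s ↦ E4.ofTimeSpace s (ξ i s)) t)))‖ + ‖(a i) • ((deriv (fun s ↦ (((Λ i s : E4 ≃L[ℝ] E4).symm : E4 →L[ℝ] E4))) t).comp ((Λ i t : E4 ≃L[ℝ] E4) : E4 →L[ℝ] E4)) (E4.basisVector 3)‖) ≤ ε * (1 + ∑ j, (‖((deriv (fun s ↦ (((Λ j s : E4 ≃L[ℝ] E4).symm : E4 →L[ℝ] E4))) t).comp ((Λ j t : E4 ≃L[ℝ] E4) : E4 →L[ℝ] E4)) (E4.basisVector 0)‖ + ‖E4.spatial (-((((Λ j t : E4 ≃L[ℝ] E4).symm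 : E4 →L[ℝ] E4)) (deriv (fun s ↦ E4.ofTimeSpace s (ξ j s)) t)))‖ + ‖(a j) • ((deriv (fun s ↦ (((Λ j s : E4 ≃L[ℝ] E4).symm : E4 →L[ℝ] E4))) t).comp ((Λ j t : E4 ≃L[ℝ] E4) : E4 →L[ℝ] E4)) (E4.basisVector 3)‖)) := fun i ε hε ↦
    firstOrder_core H1 Hγ Hsm Hsep ML i (BS i) MCL hε
  have hred : ∀ i : Fin N, Tendsto (fun t ↦ (‖((deriv (fun s ↦ (((Λ i s : E4 ≃L[ℝ] E4).symm : E4 →L[ℝ] E4))) t).comp ((Λ i t : E4 ≃L[ℝ] E4) : E4 →L[ℝ] E4)) (E4.basisVector 0)‖ + ‖E4.spatial (-((((Λ i t : E4 ≃L[ℝ] E4).symm : E4 →L[ℝ] E4)) (deriv (fun s ↦ E4.ofTimeSpace s (ξ i s)) t)))‖ + ‖(a i) • ((deriv (fun s ↦ (((Λ i s : E4 ≃L[ℝ] E4).symm : E4 →L[ℝ] E4))) t).comp ((Λ i t : E4 ≃L[ℝ] E4) : E4 →L[ℝ] E4)) (E4.basisVector 3)‖)) atTop (𝓝 0) := by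
    intro i
    refine firstOrder_absorb (red := fun (j : Fin N) (t : ℝ) ↦ (‖((deriv (fun s ↦ (((Λ j s : E4 ≃L[ℝ] E4).symm : E4 →L[ℝ] E4))) t).comp ((Λ j t : E4 ≃L[ℝ] E4) : E4 →L[ℝ] E4)) (E4.basisVector 0)‖ + ‖E4.spatial (-((((Λ j t : E4 ≃L[ℝ] E4).symm : E4 →L[ℝ] E4)) (deriv (fun s ↦ E4.ofTimeSpace s (ξ j s)) t)))‖ + ‖(a j) • ((deriv (fun s ↦ (((Λ j s : E4 ≃L[ℝ] E4).symm : E4 →L[ℝ] E4))) t).comp ((Λ j t : E4 ≃L[ℝ] E4) : E4 →L[ℝ] E4)) (E4.basisVector 3)‖)) one_pos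
      (fun j t ↦ by positivity) (fun ε hε ↦ ?_) i
    obtain ⟨T, hT⟩ := eventually_atTop.1 (eventually_all.2 fun j ↦ hcore j ε hε)
    exact ⟨T, fun t ht j ↦ by rw [one_mul]; exact hT t ht j⟩
  intro i
  have hΛ : Differentiable ℝ (fun t ↦ ((Λ i t : E4 ≃L[ℝ] E4) : E4 →L[ℝ] E4)) :=
    (Hsm i).2.differentiable (by simp)
  have hΛi : Differentiable ℝ (fun t ↦ (((Λ i t : E4 ≃L[ℝ] E4).symm : E4 →L[ℝ] E4))) :=
    (contDiff_lorentz_symm (Hsm i).2).differentiable (by simp)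
  have hξ : Differentiable ℝ (ξ i) := (Hsm i).1.differentiable (by simp)
  have hr0 : ∀ t, 0 ≤ (‖((deriv (fun s ↦ (((Λ i s : E4 ≃L[ℝ] E4).symm : E4 →L[ℝ] E4))) t).comp ((Λ i t : E4 ≃L[ℝ] E4) : E4 →L[ℝ] E4)) (E4.basisVector 0)‖ + ‖E4.spatial (-((((Λ i t : E4 ≃L[ℝ] E4).symm : E4 →L[ℝ] E4)) (deriv (fun s ↦ E4.ofTimeSpace s (ξ i s)) t)))‖ + ‖(a i) • ((deriv (fun s ↦ (((Λ i s : E4 ≃L[ℝ] E4).symm : E4 →L[ℝ] E4))) t).comp ((Λ i t : E4 ≃L[ℝ] E4) : E4 →L[ℝ] E4)) (E4.basisVector 3)‖) := fun t ↦ by positivity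
  refine firstOrder_first_of_tendsto (a := a i) (Hγ i) hΛ hΛi hξ ?_ ?_ ?_
  · refine squeeze_zero (fun t ↦ norm_nonneg _) (fun t ↦ ?_) (hred i)
    have : 0 ≤ ‖E4.spatial (-((((Λ i t : E4 ≃L[ℝ] E4).symm : E4 →L[ℝ] E4)) (deriv (fun s ↦ E4.ofTimeSpace s (ξ i s)) t)))‖ + ‖(a i) • ((deriv (fun s ↦ (((Λ i s : E4 ≃L[ℝ] E4).symm : E4 →L[ℝ] E4))) t).comp ((Λ i t : E4 ≃L[ℝ] E4) : E4 →L[ℝ] E4)) (E4.basisVector 3)‖ := by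
      positivity
    exact le_trans (le_of_eq rfl) (le_add_of_le_of_nonneg (le_add_of_nonneg_right (norm_nonneg _)) (norm_nonneg _))
  · refine squeeze_zero (fun t ↦ norm_nonneg _) (fun t ↦ ?_) (hred i)
    have e : ‖E4.spatial ((((Λ i t : E4 ≃L[ℝ] E4).symm : E4 →L[ℝ] E4)) (deriv (fun s ↦ E4.ofTimeSpace s (ξ i s)) t))‖ =
        ‖E4.spatial (-((((Λ i t : E4 ≃L[ℝ] E4).symm : E4 →L[ℝ] E4)) (deriv (fun s ↦ E4.ofTimeSpace s (ξ i s)) t)))‖ := by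
      rw [map_neg, norm_neg]
    rw [e]
    linarith [norm_nonneg (((deriv (fun s ↦ (((Λ i s : E4 ≃L[ℝ] E4).symm : E4 →L[ℝ] E4))) t).comp ((Λ i t : E4 ≃L[ℝ] E4) : E4 →L[ℝ] E4)) (E4.basisVector 0)),
      norm_nonneg ((a i) • ((deriv (fun s ↦ (((Λ i s : E4 ≃L[ℝ] E4).symm : E4 →L[ℝ] E4))) t).comp ((Λ i t : E4 ≃L[ℝ] E4) : E4 →L[ℝ] E4)) (E4.basisVector 3))]
  · intro ha
    have hpos : 0 < |a i| := abs_pos.2 ha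
    have hlim := (hred i).const_mul (|a i|⁻¹)
    rw [mul_zero] at hlim
    refine squeeze_zero (fun t ↦ norm_nonneg _) (fun t ↦ ?_) hlim
    have e : ‖deriv (fun s ↦ (((Λ i s : E4 ≃L[ℝ] E4).symm : E4 →L[ℝ] E4))) t
        ((Λ i t : E4 ≃L[ℝ] E4) (E4.basisVector 3))‖ =
        |a i|⁻¹ * ‖(a i) • ((deriv (fun s ↦ (((Λ i s : E4 ≃L[ℝ] E4).symm : E4 →L[ℝ] E4))) t).comp ((Λ i t : E4 ≃L[ℝ] E4) : E4 →L[ℝ] E4)) (E4.basisVector 3)‖ := by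
      rw [norm_smul, Real.norm_eq_abs, ← mul_assoc, inv_mul_cancel₀ hpos.ne', one_mul]
      rfl
    rw [e]
    refine mul_le_mul_of_nonneg_left ?_ (inv_nonneg.2 (abs_nonneg _))
    linarith [norm_nonneg (((deriv (fun s ↦ (((Λ i s : E4 ≃L[ℝ] E4).symm : E4 →L[ℝ] E4))) t).comp ((Λ i t : E4 ≃L[ℝ] E4) : E4 →L[ℝ] E4)) (E4.basisVector 0)), norm_nonneg (E4.spatial (-((((Λ i t : E4 ≃L[ℝ] E4).symm : E4 →L[ℝ] E4)) (deriv (fun s ↦ E4.ofTimeSpace s (ξ i s)) t))))]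

/-- **Registered one-line carrier** (`firstOrder_red_nonneg_D12`, stub (D) of the crux item; the
registered signature of `stub_firstOrderSlaving` itself exceeds the ledger's signature length):
the reduced body rate `‖Ae₀‖ + ‖d~‖ + ‖a · Ae₃‖` is nonnegative. [folklore] -/
theorem firstOrder_red_nonneg_D12 : open Literature.Geometry.Lorentzian in ∀ (A : E4 →L[ℝ] E4) (d : E4) (a : ℝ), 0 ≤ ‖A (E4.basisVector 0)‖ + ‖E4.spatial d‖ + ‖a • A (E4.basisVector 3)‖ :=
  fun A d a ↦ by positivity

end Summit.FinalStateConjecture.FinalStateConjecture.Theorems.SublinearIsFree.Slaving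

end
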